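import Mathlib.CategoryTheory.Galois.Topology
import Mathlib.CategoryTheory.Galois.Prorepresentability
import Mathlib.CategoryTheory.Comma.Over.Pullback
import Mathlib.Topology.Algebra.MulAction
import Literature.AnabelianGeometry.Anabelioids.Basic
import Literature.AnabelianGeometry.Anabelioids.TrivialObjectFibre
import HarnessLib

/-!
# Anabelioids: the local dictionary of a finite étale morphism ([GeoAn] §1.2; [SemiAnbd] Rem. 2.2.1)

Mochizuki, *The geometry of anabelioids*, Publ. RIMS **40** (2004), §1.2, Def. 1.2.2 (i) p. 17:
a morphism of connected anabelioids `φ : Y → X` is *finite étale* if `φ^* ≅ i_S^* ∘ α^*` with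
`i_S^* = (S × −) : X → X_S` and `α : Y ⥲ X_S`; Remark 1.2.2.1 (for `B(H) → B(G)`: finite étale iff
`H ↪ G` is an injection onto an open subgroup) [cite: MochizukiGeoAn2004, Def. 1.2.2(i) p.17]; and
*Semi-graphs of anabelioids*, Publ. RIMS **42** (2006), Remark 2.2.1 p. 24: along a finite étale
covering the `Π_{v'}`, `Π_{e'}` are "the stabilizers in `Π_𝒢`" of the corresponding pro-vertices
and pro-edges [cite: MochizukiSemiAnbd2006, Rem. 2.2.1 p.24].

PROOF-ONLY infrastructure (abc-iut L3 row `L3:FiniteEtaleLocalDictionary`, L6-t17; no definitions,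
statements of the tree untouched).  For an ABSTRACT Galois category `C`, an object `S`, an
equivalence `α : C_{/S} ⥤ D` onto a Galois category `D`, a functor `Q ≅ (S × −) ⋙ α` (the pull-back
functor of a finite étale morphism in the sense of `Anabelioids.IsFiniteEtale`) and a basepoint
`F` of `D`:

* `pi1Map_injective_of_star_comp`, `isPi1Mono_of_isFiniteEtale` — `π₁(φ) : Aut F → Aut (Q ⋙ F)`
  is INJECTIVE (an automorphism of `F` trivial on all `F(Q A) ≅ F(α(S × A))` is trivial on every
  `F(α(U → S))`, since `U ↪ S × U` over `S` and fibre functors send monomorphisms to injections);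
* `pi1Map_app_basePoint`, `range_pi1Map_le_stabilizer` — its image FIXES the base point
  `s₀ ∈ F(Q S)`, the image of the one-point fibre `F(α(S = S))` under the diagonal `S → S × S`
  (first half of "range = stabiliser"), stated for any basepoint `G ≅ Q ⋙ F` of `C` (the shape in
  which `SemiGraphs` consumes basepoints: `Aut.autMulEquivOfIso`);
* `isOpen_stabilizer_fiber`, `index_stabilizer_fiber` — such a stabiliser is open, and of index
  `|G(S)|` when `S` is connected (transitivity of `Aut G` on the fibre of a connected object).

The reverse inclusion (every automorphism of `Q ⋙ F` fixing `s₀` lifts to `Aut F`) and the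
branch-subgroup / double-coset dictionary of [SemiAnbd] Rem. 2.2.1 are the remaining items of the
row (HANDOFF).  Nothing here is specific to `B(G)`; for `B(H) → B(G)` this is the "⇒" half of
Remark 1.2.2.1 (tree: `bCat_res_isFiniteEtale_iff_holds`).
-/

namespace Literature.AnabelianGeometry.Anabelioids

open CategoryTheory CategoryTheory.Limits CategoryTheory.Functor CategoryTheory.PreGaloisCategory

universe u₁ u₂

section OverUnit

variable {C : Type u₁} [Category.{u₂} C] [HasBinaryProducts C] {S : C}

/-- The unit `U ⟶ S × U` of `Over.forget S ⊣ Over.star S` is a monomorphism (its underlying map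
`(u, 1) : U → S × U` is split by the second projection). [cite: MochizukiGeoAn2004, Def. 1.2.2(i) p.17] -/
theorem mono_forgetAdjStar_unit (U : Over S) : Mono ((Over.forgetAdjStar S).unit.app U) := by
  haveI : IsSplitMono ((Over.forgetAdjStar S).unit.app U).left :=
    IsSplitMono.mk' ⟨prod.snd, by rw [Over.forgetAdjStar_unit_app_left]; exact prod.lift_snd _ _⟩
  exact Over.mono_of_mono_left _

end OverUnit

variable {C : Type u₁} [Category.{u₂} C] [GaloisCategory C]
  {D : Type u₁} [Category.{u₂} D] [GaloisCategory D] {S : C}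

/-! ### Injectivity of `π₁(φ)` -/

omit [GaloisCategory D] in
/-- An automorphism of the basepoint `F` whose image under `π₁(φ)` is trivial acts trivially on
every fibre `F(α(S × A))`. [cite: MochizukiGeoAn2004, Def. 1.2.2(i) p.17] -/
theorem app_star_eq_id_of_pi1Map_eq_one (α : Over S ⥤ D) {Q : C ⥤ D} (e : Q ≅ Over.star S ⋙ α)
    (F : D ⥤ FintypeCat.{u₂}) (σ : Aut F) (hσ : pi1Map Q F σ = 1) (A : C) :
    σ.hom.app (α.obj ((Over.star S).obj A)) = 𝟙 _ := by
  have h1 : σ.hom.app (Q.obj A) = 𝟙 _ := by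
    have h := congrArg (fun τ : Aut (Q ⋙ F) => τ.hom.app A) hσ
    simp only [pi1Map_hom_app] at h
    exact h
  have hnat := σ.hom.naturality (e.hom.app A)
  -- `F(e_A) ≫ σ_{α(S×A)} = σ_{QA} ≫ F(e_A) = F(e_A)`
  rw [h1, Category.id_comp] at hnat
  exact (cancel_epi (F.map (e.hom.app A))).mp (hnat.trans (Category.comp_id _).symm)

/-- An automorphism of the basepoint `F` of `D ≃ C_{/S}` whose image under `π₁(φ)` is trivial acts
trivially on every fibre `F(α(U → S))`: `U ↪ S × U` over `S`, and `F ∘ α` sends this monomorphism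
to a monomorphism (`α` preserving monomorphisms — e.g. an equivalence).
[cite: MochizukiGeoAn2004, Def. 1.2.2(i) p.17] -/
theorem app_over_eq_id_of_pi1Map_eq_one (α : Over S ⥤ D) [α.PreservesMonomorphisms] {Q : C ⥤ D}
    (e : Q ≅ Over.star S ⋙ α) (F : D ⥤ FintypeCat.{u₂}) [FiberFunctor F] (σ : Aut F)
    (hσ : pi1Map Q F σ = 1) (U : Over S) : σ.hom.app (α.obj U) = 𝟙 _ := by
  let m : U ⟶ (Over.star S).obj U.left := (Over.forgetAdjStar S).unit.app U
  haveI : Mono m := mono_forgetAdjStar_unit U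
  haveI : Mono (α.map m) := inferInstance
  haveI : Mono (F.map (α.map m)) := inferInstance
  have hnat := σ.hom.naturality (α.map m)
  rw [app_star_eq_id_of_pi1Map_eq_one α e F σ hσ U.left, Category.comp_id] at hnat
  -- `F(α m) = σ_{αU} ≫ F(α m)`
  exact (cancel_mono (F.map (α.map m))).mp (hnat.symm.trans (Category.id_comp _).symm)

/-- **Injectivity of `π₁(φ)` for a finite étale `φ`** ([GeoAn] Def. 1.2.2 (i); the "injection"
half of Remark 1.2.2.1 for abstract connected anabelioids): if `Q ≅ (S × −) ⋙ α` with `α` an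
equivalence `C_{/S} ⥲ D`, then `π₁(φ) : Aut F → Aut (Q ⋙ F)` is injective for every basepoint `F`
of `D`. [cite: MochizukiGeoAn2004, Rem. 1.2.2.1 p.17] -/
theorem pi1Map_injective_of_star_comp (α : Over S ⥤ D) [α.IsEquivalence] {Q : C ⥤ D}
    (e : Q ≅ Over.star S ⋙ α) (F : D ⥤ FintypeCat.{u₂}) [FiberFunctor F] :
    Function.Injective (pi1Map Q F) := by
  rw [injective_iff_map_eq_one]
  intro σ hσ
  refine Iso.ext (NatTrans.ext (funext fun Y => ?_))
  -- transport from `α(α⁻¹ Y)` along the counit of the equivalence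
  have hY : σ.hom.app ((α.asEquivalence.inverse ⋙ α.asEquivalence.functor).obj Y) = 𝟙 _ :=
    app_over_eq_id_of_pi1Map_eq_one α e F σ hσ (α.inv.obj Y)
  have hnat := σ.hom.naturality (α.asEquivalence.counitIso.hom.app Y)
  rw [hY, Category.id_comp] at hnat
  have h2 : σ.hom.app ((𝟭 D).obj Y) = 𝟙 _ :=
    (cancel_epi (F.map (α.asEquivalence.counitIso.hom.app Y))).mp
      (hnat.trans (Category.comp_id _).symm)
  exact h2

/-- **Finite étale morphisms are `π₁`-monomorphisms** ([GeoAn] Def. 1.1.7 (ii), Def. 1.2.2 (i),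
Rem. 1.2.2.1): `IsFiniteEtale Q → IsPi1Mono Q` for abstract connected anabelioids.
[cite: MochizukiGeoAn2004, Rem. 1.2.2.1 p.17] -/
theorem isPi1Mono_of_isFiniteEtale {Q : C ⥤ D} (hQ : IsFiniteEtale Q) : IsPi1Mono Q := by
  obtain ⟨S, α, hα, ⟨e⟩⟩ := hQ
  intro F _
  exact pi1Map_injective_of_star_comp α e F

/-! ### The base point `s₀ ∈ F(Q S)` and the stabiliser -/

omit [GaloisCategory C] in
/-- The fibre of `α(S = S)` (the terminal object of `C_{/S}`) is a single point.
[cite: MochizukiGeoAn2004, Def. 1.2.2(i) p.17] -/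
theorem subsingleton_fiber_mkId (α : Over S ⥤ D) [α.IsEquivalence] (F : D ⥤ FintypeCat.{u₂})
    [FiberFunctor F] : Subsingleton (F.obj (α.obj (Over.mk (𝟙 S)))) := by
  have hT : IsTerminal (α.obj (Over.mk (𝟙 S))) := Over.mkIdTerminal.isTerminalObj α _
  let i : α.obj (Over.mk (𝟙 S)) ≅ ⊤_ D := hT.uniqueUpToIso terminalIsTerminal
  haveI := subsingleton_fiber_terminal F
  exact (FintypeCat.equivEquivIso.symm (F.mapIso i)).subsingleton

/-- `π₁(φ)(σ)` fixes the base point `s₀ = F(e⁻¹_S ∘ α(Δ))(t) ∈ F(Q S)`, `Δ : (S = S) → (S × S → S)`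
the diagonal (the unit of `forget ⊣ star` at `S = S`), `t` the point of the one-point fibre
`F(α(S = S))`: naturality of `σ`. [cite: MochizukiSemiAnbd2006, Rem. 2.2.1 p.24] -/
theorem pi1Map_app_basePoint (α : Over S ⥤ D) [α.IsEquivalence] {Q : C ⥤ D}
    (e : Q ≅ Over.star S ⋙ α) (F : D ⥤ FintypeCat.{u₂}) [FiberFunctor F] (σ : Aut F)
    (t : F.obj (α.obj (Over.mk (𝟙 S)))) :
    (pi1Map Q F σ).hom.app S
        (F.map (α.map ((Over.forgetAdjStar S).unit.app (Over.mk (𝟙 S))) ≫ e.inv.app S) t) =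
      F.map (α.map ((Over.forgetAdjStar S).unit.app (Over.mk (𝟙 S))) ≫ e.inv.app S) t := by
  haveI := subsingleton_fiber_mkId α F (S := S)
  rw [pi1Map_hom_app]
  exact app_map_eq_of_subsingleton F σ _ t

/-- **First half of "range `π₁(φ)` = stabiliser"** ([SemiAnbd] Rem. 2.2.1: `Π_{v'}` is the
stabiliser of a pro-vertex): for any basepoint `G ≅ Q ⋙ F` of `C` (isomorphism `β`), the image of
`π₁(φ)` followed by `β`-conjugation is contained in the stabiliser in `Aut G` of the base point
`β(s₀) ∈ G(S)`. [cite: MochizukiSemiAnbd2006, Rem. 2.2.1 p.24] -/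
theorem range_pi1Map_le_stabilizer (α : Over S ⥤ D) [α.IsEquivalence] {Q : C ⥤ D}
    (e : Q ≅ Over.star S ⋙ α) (F : D ⥤ FintypeCat.{u₂}) [FiberFunctor F]
    {G : C ⥤ FintypeCat.{u₂}} (β : Q ⋙ F ≅ G) (t : F.obj (α.obj (Over.mk (𝟙 S)))) :
    ((Aut.autMulEquivOfIso β).toMonoidHom.comp (pi1Map Q F)).range ≤
      MulAction.stabilizer (Aut G) (β.hom.app S
        (F.map (α.map ((Over.forgetAdjStar S).unit.app (Over.mk (𝟙 S))) ≫ e.inv.app S) t)) := by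
  rintro _ ⟨σ, rfl⟩
  rw [MulAction.mem_stabilizer_iff, mulAction_def]
  show (β.inv ≫ (pi1Map Q F σ).hom ≫ β.hom).app S (β.hom.app S _) = _
  rw [NatTrans.comp_app, NatTrans.comp_app, FintypeCat.comp_apply, FintypeCat.comp_apply]
  have hb : β.inv.app S (β.hom.app S
      (F.map (α.map ((Over.forgetAdjStar S).unit.app (Over.mk (𝟙 S))) ≫ e.inv.app S) t)) =
      F.map (α.map ((Over.forgetAdjStar S).unit.app (Over.mk (𝟙 S))) ≫ e.inv.app S) t := by
    rw [← FintypeCat.comp_apply, Iso.hom_inv_id_app]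
    rfl
  rw [hb, pi1Map_app_basePoint α e F σ t]

/-! ### Openness and index of the stabiliser -/

omit [GaloisCategory C] in
/-- The stabiliser of a point of a fibre is OPEN in `Aut G` for any functor `G : C ⥤ FintypeCat`
(Mathlib's profinite topology; the action on the discrete fibre is continuous).
[cite: MochizukiGeoAn2004, Rem. 1.2.2.1 p.17] -/
theorem isOpen_stabilizer_fiber (G : C ⥤ FintypeCat.{u₂}) (A : C) (x : G.obj A) :
    IsOpen (MulAction.stabilizer (Aut G) x : Set (Aut G)) :=
  stabilizer_isOpen (Aut G) x

/-- For CONNECTED `S` and a basepoint `G` of `C`, the stabiliser of a point of `G(S)` has index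
`|G(S)|` = the degree of the covering `C_{/S} → C` (transitivity of `Aut G` on the fibre of a
connected object). [cite: MochizukiGeoAn2004, Rem. 1.2.2.1 p.17] -/
theorem index_stabilizer_fiber (G : C ⥤ FintypeCat.{u₂}) [FiberFunctor G] (S : C) [IsConnected S]
    (x : G.obj S) : (MulAction.stabilizer (Aut G) x).index = Nat.card (G.obj S) :=
  MulAction.index_stabilizer_of_transitive (Aut G) x

end Literature.AnabelianGeometry.Anabelioids
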